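import Summits.ValiantsHypothesis.ValiantsHypothesis.Theorems.KPlusLogSqLawStaticPathHopsStraddleAll
import Summits.ValiantsHypothesis.ValiantsHypothesis.Theorems.KPlusLogSqLawStaticPathWallsCutCut
import Summits.ValiantsHypothesis.ValiantsHypothesis.Theorems.KPlusLogSqLawStaticPathMixedEventCrossings

/-!
# Route «KPlusLogSqLaw» — parametric max-weight independent set on a path: THEOREM T′ and the wall bound in the sweep's currency

HONEST FRAMING.  Helper toward the crux `WeakLifting` (item `stmt-ValiantsHypothesis-19561`, route `KPlusLogSqLaw`, cell `pub-symmetroid`,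
seat val-sym-lift-p4 g21, 2026-08-29) on the line of its witness-plan stub `stub_tridiagonalSectorB` (tropical twin of the STATIC tridiagonal
sector = parametric maximum-weight independent set on a path).  Transport (as `…StaticPathMixedEventCrossings.mixed_eventCrossings_card_le` did for
THEOREM T) of this seat's two counting theorems from the order-type criterion to the EVENT CROSSINGS of `…StaticPathTropicalCount.sweep_count_eq`
(the changes of the optimal independent set along a generic sweep), through `eventCrossing_iff_criterion`: (1) **`hops_eventCrossings_straddle_card_le`**
— in any window, the event crossings of two prefix-sum lines of the SAME parity (the vacancy hops) whose slopes straddle a threshold `λ` (not a slope)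
number at most `6n` (THEOREM T′, `hops_straddle_card_le`); (2) **`eventCrossings_card_le_cutCut`** — the event crossings in any window number at most
`8(n+1)` plus the number of (M)(L)(R) pairs whose two walls both cut (`card_events_le_cutCut`, ORDER.md Prop 1).  Statements about a path DP;
nothing here asserts anything about `WeakLifting`, `TropicalB`, `KPlusLogSqLaw`, the stub in its window, `MatrixDescartes` (stmt-ValiantsHypothesis-18050)
or `VP ≠ VNP`; the ORDER QUESTION stays open.
-/

set_option linter.dupNamespace false
set_option autoImplicit false

namespace Summit.ValiantsHypothesis.ValiantsHypothesis.Theorems.KPlusLogSqLaw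

open Finset Classical

namespace StaticPathFold

noncomputable section

variable (w₁ w₀ : ℕ → ℝ)

/-- **THEOREM T′ IN THE SWEEP'S CURRENCY.**  For the block `i+1, …, i+n` in general position (prefix-sum slopes pairwise distinct, no third prefix-sum
line through a crossing) and a threshold `λ` different from every prefix-sum slope, the event crossings of `sweep_count_eq` in a window `(θlo, θhi)`
formed by two prefix-sum lines of the same parity whose slopes straddle `λ` — the HOPS of a vacancy across the slope `λ` — number at most `6n`.
[folklore] -/
theorem hops_eventCrossings_straddle_card_le (i n : ℕ) (θlo θhi lam : ℝ)
    (hslope : ∀ p q, p ≤ n → q ≤ n → p ≠ q → altA (shift i w₁) p ≠ altA (shift i w₁) q)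
    (hlam : ∀ p, p ≤ n → altA (shift i w₁) p ≠ lam)
    (hgp : ∀ p q t, p ≤ n → q ≤ n → t ≤ n → p ≠ q → t ≠ p → t ≠ q →
      L (altA (shift i w₁)) (altB (shift i w₀)) t
          ((altB (shift i w₀) q - altB (shift i w₀) p) / (altA (shift i w₁) p - altA (shift i w₁) q)) ≠
        L (altA (shift i w₁)) (altB (shift i w₀)) p
          ((altB (shift i w₀) q - altB (shift i w₀) p) / (altA (shift i w₁) p - altA (shift i w₁) q))) :
    (((range (n + 1)) ×ˢ (range (n + 1))).filter (fun pq : ℕ × ℕ => pq.1 < pq.2 ∧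
        altA (shift i w₁) pq.1 ≠ altA (shift i w₁) pq.2 ∧
        θlo < (altB (shift i w₀) pq.2 - altB (shift i w₀) pq.1) / (altA (shift i w₁) pq.1 - altA (shift i w₁) pq.2) ∧
        (altB (shift i w₀) pq.2 - altB (shift i w₀) pq.1) / (altA (shift i w₁) pq.1 - altA (shift i w₁) pq.2) < θhi ∧
        lab (altA (shift i w₁)) (altB (shift i w₀)) (pq.2 - 1)
            ((altB (shift i w₀) pq.2 - altB (shift i w₀) pq.1) / (altA (shift i w₁) pq.1 - altA (shift i w₁) pq.2)) = pq.1 ∧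
        fold (altA (shift 0 (rev i n w₁))) (altB (shift 0 (rev i n w₀))) (n - pq.2)
            ((altB (shift i w₀) pq.2 - altB (shift i w₀) pq.1) / (altA (shift i w₁) pq.1 - altA (shift i w₁) pq.2)) =
          L (altA (shift 0 (rev i n w₁))) (altB (shift 0 (rev i n w₀))) (n - pq.2)
            ((altB (shift i w₀) pq.2 - altB (shift i w₀) pq.1) / (altA (shift i w₁) pq.1 - altA (shift i w₁) pq.2)) ∧
        (Even pq.1 ↔ Even pq.2) ∧
        ((altA (shift i w₁) pq.1 < lam ∧ lam < altA (shift i w₁) pq.2) ∨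
          (altA (shift i w₁) pq.2 < lam ∧ lam < altA (shift i w₁) pq.1)))).card ≤ 6 * n := by
  have hT := hops_straddle_card_le (altA (shift i w₁)) (altB (shift i w₀)) n lam hslope hlam hgp
  refine le_trans (card_le_card ?_) hT
  intro pq hpq
  simp only [mem_filter, mem_product, mem_range] at hpq ⊢
  obtain ⟨hP, h1, h2, -, -, h5, h6, h7, h8⟩ := hpq
  have hqn : pq.2 ≤ n := by omega
  have crit := (eventCrossing_iff_criterion w₁ w₀ h1 hqn h2
    (fun t ht htp htq => hgp pq.1 pq.2 t (by omega) hqn ht (ne_of_lt h1) htp htq)).mp ⟨h5, h6⟩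
  exact ⟨hP, h1, hqn, ⟨h7, h8⟩, crit.1, crit.2.1, crit.2.2⟩

/-- **THE WALL BOUND IN THE SWEEP'S CURRENCY.**  For the block `i+1, …, i+n` in general position, the event crossings of `sweep_count_eq` in a window
`(θlo, θhi)` number at most `8 (n + 1)` plus the number of pairs `p < q ≤ n` satisfying the criterion (M), (L), (R) whose right wall and left wall
both CUT (ORDER.md Proposition 1 via `card_events_le_cutCut`). [folklore] -/
theorem eventCrossings_card_le_cutCut (i n : ℕ) (θlo θhi : ℝ)
    (hslope : ∀ p q, p ≤ n → q ≤ n → p ≠ q → altA (shift i w₁) p ≠ altA (shift i w₁) q)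
    (hgp : ∀ p q t, p ≤ n → q ≤ n → t ≤ n → p ≠ q → t ≠ p → t ≠ q →
      L (altA (shift i w₁)) (altB (shift i w₀)) t
          ((altB (shift i w₀) q - altB (shift i w₀) p) / (altA (shift i w₁) p - altA (shift i w₁) q)) ≠
        L (altA (shift i w₁)) (altB (shift i w₀)) p
          ((altB (shift i w₀) q - altB (shift i w₀) p) / (altA (shift i w₁) p - altA (shift i w₁) q))) :
    (((range (n + 1)) ×ˢ (range (n + 1))).filter (fun pq : ℕ × ℕ => pq.1 < pq.2 ∧
        altA (shift i w₁) pq.1 ≠ altA (shift i w₁) pq.2 ∧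
        θlo < (altB (shift i w₀) pq.2 - altB (shift i w₀) pq.1) / (altA (shift i w₁) pq.1 - altA (shift i w₁) pq.2) ∧
        (altB (shift i w₀) pq.2 - altB (shift i w₀) pq.1) / (altA (shift i w₁) pq.1 - altA (shift i w₁) pq.2) < θhi ∧
        lab (altA (shift i w₁)) (altB (shift i w₀)) (pq.2 - 1)
            ((altB (shift i w₀) pq.2 - altB (shift i w₀) pq.1) / (altA (shift i w₁) pq.1 - altA (shift i w₁) pq.2)) = pq.1 ∧
        fold (altA (shift 0 (rev i n w₁))) (altB (shift 0 (rev i n w₀))) (n - pq.2)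
            ((altB (shift i w₀) pq.2 - altB (shift i w₀) pq.1) / (altA (shift i w₁) pq.1 - altA (shift i w₁) pq.2)) =
          L (altA (shift 0 (rev i n w₁))) (altB (shift 0 (rev i n w₀))) (n - pq.2)
            ((altB (shift i w₀) pq.2 - altB (shift i w₀) pq.1) / (altA (shift i w₁) pq.1 - altA (shift i w₁) pq.2)))).card ≤
      8 * (n + 1) +
      (((range (n + 1)) ×ˢ (range (n + 1))).filter (fun pq : ℕ × ℕ => pq.1 < pq.2 ∧ pq.2 ≤ n ∧
        (∀ t, pq.1 < t → t < pq.2 →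
          0 < gap t (L (altA (shift i w₁)) (altB (shift i w₀)) pq.1
              ((altB (shift i w₀) pq.2 - altB (shift i w₀) pq.1) / (altA (shift i w₁) pq.1 - altA (shift i w₁) pq.2)))
            (L (altA (shift i w₁)) (altB (shift i w₀)) t
              ((altB (shift i w₀) pq.2 - altB (shift i w₀) pq.1) / (altA (shift i w₁) pq.1 - altA (shift i w₁) pq.2)))) ∧
        (∃ r, Even r ∧ r ≤ pq.1 ∧
          (∀ t, pq.1 - r ≤ t → t < pq.1 →
            0 < gap t (L (altA (shift i w₁)) (altB (shift i w₀)) pq.1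
                ((altB (shift i w₀) pq.2 - altB (shift i w₀) pq.1) / (altA (shift i w₁) pq.1 - altA (shift i w₁) pq.2)))
              (L (altA (shift i w₁)) (altB (shift i w₀)) t
                ((altB (shift i w₀) pq.2 - altB (shift i w₀) pq.1) / (altA (shift i w₁) pq.1 - altA (shift i w₁) pq.2)))) ∧
          (r = pq.1 ∨ ¬ 0 < gap (pq.1 - r - 1) (L (altA (shift i w₁)) (altB (shift i w₀)) pq.1
              ((altB (shift i w₀) pq.2 - altB (shift i w₀) pq.1) / (altA (shift i w₁) pq.1 - altA (shift i w₁) pq.2)))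
            (L (altA (shift i w₁)) (altB (shift i w₀)) (pq.1 - r - 1)
              ((altB (shift i w₀) pq.2 - altB (shift i w₀) pq.1) / (altA (shift i w₁) pq.1 - altA (shift i w₁) pq.2))))) ∧
        (∃ r, Even r ∧ pq.2 + r ≤ n ∧
          (∀ t, pq.2 < t → t ≤ pq.2 + r →
            0 < gap t (L (altA (shift i w₁)) (altB (shift i w₀)) pq.1
                ((altB (shift i w₀) pq.2 - altB (shift i w₀) pq.1) / (altA (shift i w₁) pq.1 - altA (shift i w₁) pq.2)))
              (L (altA (shift i w₁)) (altB (shift i w₀)) t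
                ((altB (shift i w₀) pq.2 - altB (shift i w₀) pq.1) / (altA (shift i w₁) pq.1 - altA (shift i w₁) pq.2)))) ∧
          (pq.2 + r = n ∨ ¬ 0 < gap (pq.2 + r + 1) (L (altA (shift i w₁)) (altB (shift i w₀)) pq.1
              ((altB (shift i w₀) pq.2 - altB (shift i w₀) pq.1) / (altA (shift i w₁) pq.1 - altA (shift i w₁) pq.2)))
            (L (altA (shift i w₁)) (altB (shift i w₀)) (pq.2 + r + 1)
              ((altB (shift i w₀) pq.2 - altB (shift i w₀) pq.1) / (altA (shift i w₁) pq.1 - altA (shift i w₁) pq.2))))) ∧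
        (∃ r, pq.2 + r + 1 ≤ n ∧
          (∀ t, pq.2 < t → t ≤ pq.2 + r →
            0 < gap t (L (altA (shift i w₁)) (altB (shift i w₀)) pq.1
                ((altB (shift i w₀) pq.2 - altB (shift i w₀) pq.1) / (altA (shift i w₁) pq.1 - altA (shift i w₁) pq.2)))
              (L (altA (shift i w₁)) (altB (shift i w₀)) t
                ((altB (shift i w₀) pq.2 - altB (shift i w₀) pq.1) / (altA (shift i w₁) pq.1 - altA (shift i w₁) pq.2)))) ∧
          ¬ 0 < gap (pq.2 + r + 1) (L (altA (shift i w₁)) (altB (shift i w₀)) pq.1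
              ((altB (shift i w₀) pq.2 - altB (shift i w₀) pq.1) / (altA (shift i w₁) pq.1 - altA (shift i w₁) pq.2)))
            (L (altA (shift i w₁)) (altB (shift i w₀)) (pq.2 + r + 1)
              ((altB (shift i w₀) pq.2 - altB (shift i w₀) pq.1) / (altA (shift i w₁) pq.1 - altA (shift i w₁) pq.2))) ∧
          ∃ θ, ∀ t, pq.1 < t → t ≤ pq.2 + r + 1 →
            0 < gap t (L (altA (shift i w₁)) (altB (shift i w₀)) pq.1 θ) (L (altA (shift i w₁)) (altB (shift i w₀)) t θ)) ∧
        (∃ r, r + 1 ≤ pq.1 ∧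
          (∀ t, pq.1 - r ≤ t → t < pq.1 →
            0 < gap t (L (altA (shift i w₁)) (altB (shift i w₀)) pq.1
                ((altB (shift i w₀) pq.2 - altB (shift i w₀) pq.1) / (altA (shift i w₁) pq.1 - altA (shift i w₁) pq.2)))
              (L (altA (shift i w₁)) (altB (shift i w₀)) t
                ((altB (shift i w₀) pq.2 - altB (shift i w₀) pq.1) / (altA (shift i w₁) pq.1 - altA (shift i w₁) pq.2)))) ∧
          ¬ 0 < gap (pq.1 - r - 1) (L (altA (shift i w₁)) (altB (shift i w₀)) pq.1
              ((altB (shift i w₀) pq.2 - altB (shift i w₀) pq.1) / (altA (shift i w₁) pq.1 - altA (shift i w₁) pq.2)))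
            (L (altA (shift i w₁)) (altB (shift i w₀)) (pq.1 - r - 1)
              ((altB (shift i w₀) pq.2 - altB (shift i w₀) pq.1) / (altA (shift i w₁) pq.1 - altA (shift i w₁) pq.2))) ∧
          ∃ θ, ∀ t, pq.1 - r - 1 ≤ t → t < pq.2 →
            0 < gap t (L (altA (shift i w₁)) (altB (shift i w₀)) pq.2 θ) (L (altA (shift i w₁)) (altB (shift i w₀)) t θ)))).card := by
  have hW := card_events_le_cutCut (altA (shift i w₁)) (altB (shift i w₀)) n hslope
  refine le_trans (card_le_card ?_) hW
  intro pq hpq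
  simp only [mem_filter, mem_product, mem_range] at hpq ⊢
  obtain ⟨hP, h1, h2, -, -, h5, h6⟩ := hpq
  have hqn : pq.2 ≤ n := by omega
  have crit := (eventCrossing_iff_criterion w₁ w₀ h1 hqn h2
    (fun t ht htp htq => hgp pq.1 pq.2 t (by omega) hqn ht (ne_of_lt h1) htp htq)).mp ⟨h5, h6⟩
  exact ⟨hP, h1, hqn, crit.1, crit.2.1, crit.2.2⟩

end

end StaticPathFold

end Summit.ValiantsHypothesis.ValiantsHypothesis.Theorems.KPlusLogSqLaw
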